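import Summits.MatrixMultiplication.MatrixMultiplication.Theorems.SoloBlindRelativeDegeneration
import Summits.MatrixMultiplication.MatrixMultiplication.Statement
import Literature.Computability.AlgebraicComplexity.AsymptoticRankBorderRank
import Literature.Computability.AlgebraicComplexity.CoppersmithWinograd1990Proofs
import Literature.Computability.AlgebraicComplexity.BorderRankDirectSum
import HarnessLib

/-!
# The additivity dichotomy for the Coppersmith–Winograd free lunch

`Summits/MatrixMultiplication/MatrixMultiplication/Theorems` (soloist file, blind arm).

Write `T = T_{cw,2}` (`cwTensor ℂ 2`, border rank `4`, `R̃(T) = 3 ⟹ ω = 2`) and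
`t_n = 4^n - 2·3^n + 2^n`.  Alman–Li (arXiv:2605.21738, Prop. 7.1) degenerate
`T^{⊠n} ⊕ ⟨1, t_n, 1⟩ ⊴ ⟨4^n⟩ ⊕ ⟨1, 2^n, 1⟩`, whence the *free lunch*
`bR(T^{⊠n} ⊕ ⟨1,t_n,1⟩) ≤ 4^n + 2^n` although `bR⟨1,t_n,1⟩ = t_n`.  This file records what that
construction says about LOWER bounds:

* `soloAdd_matrixMultiplication_of_asymptoticRank_le_three` — the door in asymptotic-rank language:
  **`R̃(T_{cw,2}) ≤ 3 ⟹ ω(ℂ) = 2`** (the tree's door `matrixMultiplication_of_cw_two` takes the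
  growth form `R(T^{⊠N}) = O(3^{(1+ε)N})`; here it is derived from the infimum `asymptoticRank`).
* `soloAdd_asymptoticRank_le_three_of_frequently_le` — sub-exponential slack suffices:
  if `bR(T^{⊠n}) ≤ c · 3^n` for infinitely many `n` (any fixed `c`), then `R̃(T) ≤ 3`, hence `ω = 2`
  (`soloAdd_matrixMultiplication_of_frequently_le`).
* `soloAdd_matrixMultiplication_of_additive` — **the additivity reading**: if border rank is
  ADDITIVE on the free-lunch pair `(T^{⊠n}, ⟨1,t_n,1⟩)` for infinitely many `n`
  (`bR(T^{⊠n}) + t_n ≤ bR(T^{⊠n} ⊕ ⟨1,t_n,1⟩)`), then the free lunch forces `bR(T^{⊠n}) ≤ 2·3^n`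
  for those `n` and therefore `ω(ℂ) = 2`.  (Strassen's additivity conjecture fails for border rank in
  general — Schönhage 1981; the point is that its failure ALONG THIS ONE SEQUENCE is what a proof of
  `R̃(T_{cw,2}) > 3` must establish.)
* `soloAdd_subadditivityDefect_ge` — the converse bookkeeping: the sub-additivity defect
  `δ_n = bR(T^{⊠n}) + t_n - bR(T^{⊠n} ⊕ ⟨1,t_n,1⟩)` satisfies `δ_n ≥ R̃(T)^n - 2·3^n`; so if the
  door is shut (`R̃(T) = ρ > 3`) border rank is strictly sub-additive on the pair for all large `n`,
  by a volume-scale amount `≥ ρ^n - 2·3^n`.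

The free lunch enters only as the explicit hypothesis `hFL` (Alman–Li 2026, Prop. 7.1 with the
monotonicity and sub-additivity of border rank); nothing of that paper is re-proved here.

References: J. Alman, B. Li, *Asymptotic rank speedup theorems, revisited*, arXiv:2605.21738, Prop. 7.1;
A. Schönhage, *Partial and total matrix multiplication*, SIAM J. Comput. 10 (1981);
P. Bürgisser, M. Clausen, M. A. Shokrollahi, *Algebraic Complexity Theory* (1997), §15.4–15.6.
-/

noncomputable section

namespace Summit.MatrixMultiplication.MatrixMultiplication.Theorems

open Literature.Computability.AlgebraicComplexity Literature.Barriers.MatrixMultiplication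
open Filter Asymptotics

/-- `R̃(t)^k ≤ R̃(t^{⊠k})` for `k ≥ 1` (from the termwise form `soloRelDeg_pow_le_rankTerm`). [folklore] -/
theorem soloAdd_pow_le_asymptoticRank_kroneckerPow {ι κ μ : Type} [Fintype ι] [Fintype κ] [Fintype μ]
    [DecidableEq ι] [DecidableEq κ] [DecidableEq μ] (t : ι → κ → μ → ℂ) {k : ℕ} (hk : 0 < k) :
    asymptoticRank t ^ k ≤ asymptoticRank (kroneckerPow t k) :=
  le_ciInf fun N => soloRelDeg_pow_le_rankTerm t hk N

/-- **The door in asymptotic-rank language: `R̃(T_{cw,2}) ≤ 3 ⟹ ω(ℂ) = 2`.**  From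
`R̃(T) = inf_k R(T^{⊠k})^{1/k} ≤ 3 < 3^{1+ε}` pick `k` with `R(T^{⊠k})^{1/k} < 3^{1+ε}`; then
`R(T^{⊠N}) ≤ M^k (R(T^{⊠k})^{1/k})^N ≤ M^k 3^{(1+ε)N}` (`tensorRank_kroneckerPow_cwTensor_le`), which is
the hypothesis of the proved laser-method form `CoppersmithWinograd1990_asymptoticRank_form_holds`.
[cite: ConnerGesmundoLandsbergVentura2022, p. 3] -/
theorem soloAdd_matrixMultiplication_of_asymptoticRank_le_three
    (H : asymptoticRank (cwTensor ℂ 2) ≤ 3) :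
    Literature.Computability.AlgebraicComplexity.MatrixMultiplication := by
  refine matrixMultiplication_of_cw_two CoppersmithWinograd1990_asymptoticRank_form_holds
    (omega_two_le ℂ) ?_
  intro ε hε
  -- a finite exponent `k` witnessing `R(T^{⊠k})^{1/k} < 3^{1+ε}`
  have h3 : (3 : ℝ) < (3 : ℝ) ^ (1 + ε) := by
    have : (3 : ℝ) ^ (1 : ℝ) < (3 : ℝ) ^ (1 + ε) :=
      Real.rpow_lt_rpow_of_exponent_lt (by norm_num) (by linarith)
    simpa using this
  have hinf : asymptoticRank (cwTensor ℂ 2) < (3 : ℝ) ^ (1 + ε) := lt_of_le_of_lt H h3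
  obtain ⟨N₀, hN₀⟩ := exists_lt_of_ciInf_lt hinf
  set k : ℕ := N₀ + 1 with hk
  have hk1 : 1 ≤ k := by omega
  set ρ : ℝ := ((tensorRank (kroneckerPow (cwTensor ℂ 2) k) : ℝ) ^ ((k : ℝ)⁻¹)) with hρ
  have hρlt : ρ < (3 : ℝ) ^ (1 + ε) := by
    have e : ((k : ℝ)⁻¹) = ((N₀ : ℝ) + 1)⁻¹ := by rw [hk]; push_cast; ring
    rw [hρ, e]; exact hN₀
  have hρ0 : 0 ≤ ρ := by rw [hρ]; positivity
  set M : ℕ := max 1 (tensorRank (kroneckerPow (cwTensor ℂ 2) 1)) with hM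
  refine IsBigO.of_bound ((M : ℝ) ^ k) (Eventually.of_forall fun N => ?_)
  rw [Real.norm_of_nonneg (Nat.cast_nonneg _),
    Real.norm_of_nonneg (Real.rpow_pos_of_pos (by norm_num) _).le]
  have h1 : (tensorRank (kroneckerPow (cwTensor ℂ 2) N) : ℝ) ≤ (M : ℝ) ^ k * ρ ^ N :=
    tensorRank_kroneckerPow_cwTensor_le 2 k (by norm_num) hk1 N
  have h2 : ρ ^ N ≤ ((3 : ℝ) ^ (1 + ε)) ^ N := pow_le_pow_left₀ hρ0 hρlt.le N
  have h3' : ((3 : ℝ) ^ (1 + ε)) ^ N = (3 : ℝ) ^ ((1 + ε) * N) := by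
    rw [← Real.rpow_natCast, ← Real.rpow_mul (by norm_num)]
  calc (tensorRank (kroneckerPow (cwTensor ℂ 2) N) : ℝ)
      ≤ (M : ℝ) ^ k * ρ ^ N := h1
    _ ≤ (M : ℝ) ^ k * ((3 : ℝ) ^ (1 + ε)) ^ N := mul_le_mul_of_nonneg_left h2 (by positivity)
    _ = (M : ℝ) ^ k * (3 : ℝ) ^ ((1 + ε) * N) := by rw [h3']

/-- **Sub-exponential slack suffices.**  If `bR(T_{cw,2}^{⊠n}) ≤ c · 3^n` for infinitely many `n`
(`c` fixed), then `R̃(T_{cw,2}) ≤ 3`: indeed `R̃(T)^n ≤ R̃(T^{⊠n}) ≤ bR(T^{⊠n}) ≤ c 3^n`, and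
`(R̃(T)/3)^n ≤ c` infinitely often forces `R̃(T)/3 ≤ 1` (Bernoulli). [folklore] -/
theorem soloAdd_asymptoticRank_le_three_of_frequently_le (c : ℕ)
    (h : ∀ N : ℕ, ∃ n : ℕ, N ≤ n ∧
      algBorderRank (kroneckerPow (cwTensor ℂ 2) n) ≤ c * 3 ^ n) :
    asymptoticRank (cwTensor ℂ 2) ≤ 3 := by
  set T := cwTensor ℂ 2 with hT
  have hA0 : 0 ≤ asymptoticRank T := asymptoticRank_nonneg _
  -- the key bound along the subsequence
  have key : ∀ n : ℕ, 1 ≤ n → algBorderRank (kroneckerPow T n) ≤ c * 3 ^ n →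
      asymptoticRank T ^ n ≤ (c : ℝ) * 3 ^ n := by
    intro n hn hb
    calc asymptoticRank T ^ n ≤ asymptoticRank (kroneckerPow T n) :=
          soloAdd_pow_le_asymptoticRank_kroneckerPow T (by omega)
      _ ≤ algBorderRank (kroneckerPow T n) := asymptoticRank_le_algBorderRank _
      _ ≤ ((c * 3 ^ n : ℕ) : ℝ) := by exact_mod_cast hb
      _ = (c : ℝ) * 3 ^ n := by push_cast; ring
  by_contra hgt
  push Not at hgt
  -- `x = R̃(T)/3 - 1 > 0`, and `(1+x)^n ≥ 1 + n x > c` for `n` large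
  set x : ℝ := asymptoticRank T / 3 - 1 with hx
  have hx0 : 0 < x := by rw [hx]; linarith
  obtain ⟨N, hN⟩ := exists_nat_gt ((c : ℝ) / x)
  obtain ⟨n, hNn, hb⟩ := h (max N 1)
  have hn1 : 1 ≤ n := le_trans (le_max_right _ _) hNn
  have hnN : N ≤ n := le_trans (le_max_left _ _) hNn
  have hkey := key n hn1 hb
  have hpow : asymptoticRank T ^ n = (3 : ℝ) ^ n * (1 + x) ^ n := by
    rw [← mul_pow]; congr 1; rw [hx]; ring
  have hbern : 1 + (n : ℝ) * x ≤ (1 + x) ^ n :=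
    one_add_mul_le_pow (by linarith) n
  have hnx : (c : ℝ) < (n : ℝ) * x := by
    have : (c : ℝ) / x < n := lt_of_lt_of_le hN (by exact_mod_cast hnN)
    rwa [div_lt_iff₀ hx0] at this
  have h3n : (0 : ℝ) < 3 ^ n := by positivity
  have : (3 : ℝ) ^ n * (1 + x) ^ n ≤ (c : ℝ) * 3 ^ n := hpow ▸ hkey
  have : (1 + x) ^ n ≤ (c : ℝ) := by
    rw [mul_comm] at this
    exact le_of_mul_le_mul_right this h3n
  linarith

/-- `ω(ℂ) = 2` from `bR(T_{cw,2}^{⊠n}) ≤ c · 3^n` infinitely often. [folklore] -/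
theorem soloAdd_matrixMultiplication_of_frequently_le (c : ℕ)
    (h : ∀ N : ℕ, ∃ n : ℕ, N ≤ n ∧
      algBorderRank (kroneckerPow (cwTensor ℂ 2) n) ≤ c * 3 ^ n) :
    Literature.Computability.AlgebraicComplexity.MatrixMultiplication :=
  soloAdd_matrixMultiplication_of_asymptoticRank_le_three
    (soloAdd_asymptoticRank_le_three_of_frequently_le c h)

/-- `2 · 3^n ≤ 4^n + 2^n` (midpoint convexity of `x ↦ x^n` on `2, 3, 4`), so that the free-lunch size
`t_n = 4^n + 2^n - 2·3^n` is a genuine natural-number difference. [folklore] -/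
theorem soloAdd_two_mul_three_pow_le (n : ℕ) : 2 * 3 ^ n ≤ 4 ^ n + 2 ^ n := by
  induction n with
  | zero => norm_num
  | succ m ih =>
    have h42 : 2 ^ m ≤ 4 ^ m := Nat.pow_le_pow_left (by norm_num) m
    have e1 : 2 * 3 ^ (m + 1) = 3 * (2 * 3 ^ m) := by ring
    have e2 : 4 ^ (m + 1) + 2 ^ (m + 1) = 3 * (4 ^ m + 2 ^ m) + (4 ^ m - 2 ^ m) := by
      rw [pow_succ, pow_succ]; omega
    rw [e1, e2]
    have := Nat.mul_le_mul_left 3 ih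
    omega

/-- **The additivity reading of the free lunch.**  Hypothesis `hFL` is the Alman–Li free lunch in
border-rank form, `bR(T^{⊠n} ⊕ ⟨1,t_n,1⟩) ≤ 4^n + 2^n` with `t_n = 4^n + 2^n - 2·3^n`
(arXiv:2605.21738, Prop. 7.1, read through the monotonicity of `bR` under degeneration and its
sub-additivity).  If border rank is additive on the pair `(T^{⊠n}, ⟨1,t_n,1⟩)` for infinitely many
`n`, then `bR(T^{⊠n}) ≤ 2·3^n` for those `n`, hence `ω(ℂ) = 2`. [cite: AlmanLi2026, Prop 7.1] -/
theorem soloAdd_matrixMultiplication_of_additive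
    (hFL : ∀ n : ℕ, 1 ≤ n →
      algBorderRank (directSumTensor (kroneckerPow (cwTensor ℂ 2) n)
        (matMulTensor (K := ℂ) 1 (4 ^ n + 2 ^ n - 2 * 3 ^ n) 1)) ≤ 4 ^ n + 2 ^ n)
    (hadd : ∀ N : ℕ, ∃ n : ℕ, N ≤ n ∧
      algBorderRank (kroneckerPow (cwTensor ℂ 2) n) + (4 ^ n + 2 ^ n - 2 * 3 ^ n) ≤
        algBorderRank (directSumTensor (kroneckerPow (cwTensor ℂ 2) n)
          (matMulTensor (K := ℂ) 1 (4 ^ n + 2 ^ n - 2 * 3 ^ n) 1))) :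
    Literature.Computability.AlgebraicComplexity.MatrixMultiplication := by
  refine soloAdd_matrixMultiplication_of_frequently_le 2 fun N => ?_
  obtain ⟨n, hNn, hn⟩ := hadd (max N 1)
  refine ⟨n, le_trans (le_max_left _ _) hNn, ?_⟩
  have hn1 : 1 ≤ n := le_trans (le_max_right _ _) hNn
  have h1 := hFL n hn1
  have h2 := soloAdd_two_mul_three_pow_le n
  omega

/-- **The defect bound.**  With `hFL` as above, the sub-additivity defect of border rank on the
free-lunch pair satisfies `δ_n = bR(T^{⊠n}) + t_n - bR(T^{⊠n} ⊕ ⟨1,t_n,1⟩) ≥ R̃(T)^n - 2·3^n`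
(`R̃(T)^n ≤ R̃(T^{⊠n}) ≤ bR(T^{⊠n})`).  In particular `R̃(T_{cw,2}) = ρ > 3` forces strict
sub-additivity `δ_n > 0` as soon as `ρ^n > 2·3^n`. [cite: AlmanLi2026, Prop 7.1] -/
theorem soloAdd_subadditivityDefect_ge
    (hFL : ∀ n : ℕ, 1 ≤ n →
      algBorderRank (directSumTensor (kroneckerPow (cwTensor ℂ 2) n)
        (matMulTensor (K := ℂ) 1 (4 ^ n + 2 ^ n - 2 * 3 ^ n) 1)) ≤ 4 ^ n + 2 ^ n)
    (n : ℕ) (hn : 1 ≤ n) :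
    asymptoticRank (cwTensor ℂ 2) ^ n - 2 * 3 ^ n ≤
      (algBorderRank (kroneckerPow (cwTensor ℂ 2) n) : ℝ) + ((4 ^ n + 2 ^ n - 2 * 3 ^ n : ℕ) : ℝ)
        - algBorderRank (directSumTensor (kroneckerPow (cwTensor ℂ 2) n)
            (matMulTensor (K := ℂ) 1 (4 ^ n + 2 ^ n - 2 * 3 ^ n) 1)) := by
  have h1 : asymptoticRank (cwTensor ℂ 2) ^ n ≤ algBorderRank (kroneckerPow (cwTensor ℂ 2) n) :=
    (soloAdd_pow_le_asymptoticRank_kroneckerPow (cwTensor ℂ 2) (by omega)).trans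
      (asymptoticRank_le_algBorderRank _)
  have h2 : (algBorderRank (directSumTensor (kroneckerPow (cwTensor ℂ 2) n)
      (matMulTensor (K := ℂ) 1 (4 ^ n + 2 ^ n - 2 * 3 ^ n) 1)) : ℝ) ≤ ((4 ^ n + 2 ^ n : ℕ) : ℝ) := by
    exact_mod_cast hFL n hn
  have h3 : (((4 ^ n + 2 ^ n - 2 * 3 ^ n : ℕ) : ℝ)) = (4 : ℝ) ^ n + 2 ^ n - 2 * 3 ^ n := by
    have := soloAdd_two_mul_three_pow_le n
    push_cast [Nat.cast_sub this]
    ring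
  push_cast at h2
  rw [h3]
  linarith

/-- The strict form: if `R̃(T_{cw,2})^n > 2 · 3^n` then border rank is strictly sub-additive on the
free-lunch pair at exponent `n`. [cite: AlmanLi2026, Prop 7.1] -/
theorem soloAdd_strictSubadditive_of_pow_gt
    (hFL : ∀ n : ℕ, 1 ≤ n →
      algBorderRank (directSumTensor (kroneckerPow (cwTensor ℂ 2) n)
        (matMulTensor (K := ℂ) 1 (4 ^ n + 2 ^ n - 2 * 3 ^ n) 1)) ≤ 4 ^ n + 2 ^ n)
    (n : ℕ) (hn : 1 ≤ n) (hgt : (2 : ℝ) * 3 ^ n < asymptoticRank (cwTensor ℂ 2) ^ n) :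
    algBorderRank (directSumTensor (kroneckerPow (cwTensor ℂ 2) n)
        (matMulTensor (K := ℂ) 1 (4 ^ n + 2 ^ n - 2 * 3 ^ n) 1)) <
      algBorderRank (kroneckerPow (cwTensor ℂ 2) n) + (4 ^ n + 2 ^ n - 2 * 3 ^ n) := by
  have h := soloAdd_subadditivityDefect_ge hFL n hn
  have : (0 : ℝ) < (algBorderRank (kroneckerPow (cwTensor ℂ 2) n) : ℝ)
      + ((4 ^ n + 2 ^ n - 2 * 3 ^ n : ℕ) : ℝ)
      - algBorderRank (directSumTensor (kroneckerPow (cwTensor ℂ 2) n)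
          (matMulTensor (K := ℂ) 1 (4 ^ n + 2 ^ n - 2 * 3 ^ n) 1)) := by linarith
  exact_mod_cast (by linarith : ((algBorderRank (directSumTensor (kroneckerPow (cwTensor ℂ 2) n)
      (matMulTensor (K := ℂ) 1 (4 ^ n + 2 ^ n - 2 * 3 ^ n) 1)) : ℝ)) <
    (algBorderRank (kroneckerPow (cwTensor ℂ 2) n) : ℝ) + ((4 ^ n + 2 ^ n - 2 * 3 ^ n : ℕ) : ℝ))

/-- The summit-decl form (`Summits/MatrixMultiplication/MatrixMultiplication/Statement.lean`, root-level `MatrixMultiplication`) of the additivity reading. [cite: AlmanLi2026, Prop 7.1] -/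
theorem soloAdd_summit_of_additive
    (hFL : ∀ n : ℕ, 1 ≤ n →
      algBorderRank (directSumTensor (kroneckerPow (cwTensor ℂ 2) n)
        (matMulTensor (K := ℂ) 1 (4 ^ n + 2 ^ n - 2 * 3 ^ n) 1)) ≤ 4 ^ n + 2 ^ n)
    (hadd : ∀ N : ℕ, ∃ n : ℕ, N ≤ n ∧
      algBorderRank (kroneckerPow (cwTensor ℂ 2) n) + (4 ^ n + 2 ^ n - 2 * 3 ^ n) ≤
        algBorderRank (directSumTensor (kroneckerPow (cwTensor ℂ 2) n)
          (matMulTensor (K := ℂ) 1 (4 ^ n + 2 ^ n - 2 * 3 ^ n) 1))) :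
    _root_.MatrixMultiplication :=
  soloAdd_matrixMultiplication_of_additive hFL hadd

end Summit.MatrixMultiplication.MatrixMultiplication.Theorems

end
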